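import Summits.QuantumAdvantage.QuantumAdvantage.Theorems.CubicForrelationSignedExactCubicForrelationNotPrBPPGrowMachineLaw
import Summits.QuantumAdvantage.QuantumAdvantage.Theorems.CubicForrelationSignedExactCubicForrelationNotPrBPPGrowMachineTerminal
import Summits.QuantumAdvantage.QuantumAdvantage.Theorems.CubicForrelationSignedExactCubicForrelationNotPrBPPStubPlumbing
import Literature.Computability.QuantumComplexity.MSubspaceSignReadoutRelaxedRuns

/-!
# Crux `CubicForrelation.SignedExactCubicForrelationNotPrBPP` (stmt-QuantumAdvantage-13932), line `dual-pingpong-frame`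
# (GROW reshape): the GROW machine, XIV — completeness and the registered stub `stub_growFinder`

Stub `stub_growFinder` of line `dual-pingpong-frame` (GROW reshape): **the line's kernel statistics and the
closedness of M-pairs make the coin finder `growFind` (files I–III) complete with probability `≥ 2/3`** on every
two-circuit instance over `B₂` with cubic circuits, `Φ = ±1`, and `b = C₁` on a completed Maiorana–McFarland orbit,
with the coin polynomial `3 (ℓ+1)² (ℓ+3)¹⁰`; together with `growFind ∈ FP` and the soundness `growFind_sound` (file III)
this is the registered statement `KernelStats → MPairClosed → PairFinderMMCoins`.

Proof of completeness (`growFind_complete`). Under the promise the size guard holds (`Plumbing.n_le_of_value`), so the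
machine runs `growCore = outCtx n m c_f c_g`: `n` STAGES of `3 (n+2)⁹` TRIALS on fresh chunks; the invariant (bases of
length `≤ m`, closed both ways, orthogonal) holds throughout (`trialC_sound`), a terminal state passes the certificate
(`certOK_rowsOut`, frame lock on the `a`-side), so the output is non-empty once the final state is terminal. From a
non-terminal state the kernel statistics (hypothesis 1 at the current spans) give `r ≤ n + 1` probes and a side on which a
uniform candidate is NEW GOOD with probability `≥ (n+2)⁻⁸`; good candidates are accepted (`tryB_complete`, inside the
closed orthogonal M-pair of hypothesis 2) and the machine's candidate has exactly that law (`uniformProb_cand_mem`), so a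
trial changes the state with probability `≥ (n+2)⁻⁸` (`uniformProb_tryB_ge`); the union bound over stages
(`uniformProb_not_term_le`, Arora–Barak §7.4.1) bounds the failure probability by `n (1 - (n+2)⁻⁸)^{3 (n+2)⁹} ≤ 1/3`.

References: S. Arora, B. Barak, *Computational Complexity: A Modern Approach*, CUP 2009, §1.3, §7.1, §7.4.1
[AroraBarak2009]; C. Carlet, *Boolean Functions for Cryptography and Coding Theory*, CUP 2021, Prop. 54, Prop. 77
[Carlet2020]; O. Goldreich, *On promise problems*, 2006, Def. 1.2 [Goldreich2006]. -/

noncomputable section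

set_option linter.dupNamespace false -- D-0017: single-problem summit ⇒ `QuantumAdvantage.QuantumAdvantage` by design

namespace Summit.QuantumAdvantage.QuantumAdvantage.Theorems.SignedExactCubicForrelationNotPrBPP

open Finset
open Literature.Computability.Complexity Literature.Computability.QuantumComplexity
open Literature.Computability.Complexity.F2Elim
open Literature.Computability.QuantumComplexity.BuzetChailloux (bxor zeroVec)
open PolarGeometry (bdot_comm)
open NoTrap (D_zeroVec_eq)
open ForrCode QuadSampler MMReadout CubicDequant
open FinderMachine (Vec Mat)
open GrowMachine
open Literature.Computability.QuantumComplexity (uniformProb_mono_of_length')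

namespace GrowMachine

/-- The offset clause in `f`-form gives the offset clause in `D`-form (converse of `offs_fform`). [cite: Carlet2020, §2.2.2] -/
theorem offs_Dform {n : ℕ} {f : (Fin n → Bool) → Bool} (D : (Fin n → Bool) → (Fin n → Bool) → (Fin n → Bool) → Bool)
    (hD : ∀ u v x, D u v x = (f x ^^ f (bxor x u) ^^ f (bxor x v) ^^ f (bxor x (bxor u v)))) {A B : Finset (Fin n → Bool)}
    (h : ∀ s ∈ A, ∃ ℓ ∈ B, ∀ r : Fin n → Bool, (∀ y z : Fin n → Bool, (D s r z ^^ D s r (bxor z y)) = false) →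
        (f r ^^ f (bxor r s) ^^ f zeroVec ^^ f s) = (univ.filter fun i => ℓ i && r i).card.bodd) :
    ∀ s ∈ A, ∃ ℓ ∈ B, ∀ r : Fin n → Bool, (∀ y z : Fin n → Bool, (D s r z ^^ D s r (bxor z y)) = false) →
        D s r zeroVec = (univ.filter fun i => ℓ i && r i).card.bodd := by
  intro s hs
  obtain ⟨ℓ, hℓ, h'⟩ := h s hs
  exact ⟨ℓ, hℓ, fun r hr => by rw [D_zeroVec_eq D hD]; exact h' r hr⟩

/-- The value of `growCore` on a promise instance: the guard passes and the machine runs `outCtx n m C₀ C₁`.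
[cite: Goldreich2006, Def. 1.2] -/
theorem growCore_mk_two (m : ℕ) (C : Fin 2 → Circuit (Fin (m + m))) (hn : m + m ≤ (KForrelationInstance.encode ⟨m + m, 2, C⟩).length + 1)
    (y : List Bool) : growCore (instOf ⟨m + m, 2, C⟩) (KForrelationInstance.encode ⟨m + m, 2, C⟩).length y =
      outCtx (m + m) m (pcircOf (C 0)) (pcircOf (C 1)) y := by
  have h0 : circAt (instOf ⟨m + m, 2, C⟩) 0 = pcircOf (C 0) := circAt_instOf ⟨m + m, 2, C⟩ (0 : Fin 2)
  have h1 : circAt (instOf ⟨m + m, 2, C⟩) 1 = pcircOf (C 1) := circAt_instOf ⟨m + m, 2, C⟩ (1 : Fin 2)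
  have hne : nEff (instOf ⟨m + m, 2, C⟩) (KForrelationInstance.encode ⟨m + m, 2, C⟩).length = m + m := min_eq_left hn
  rw [growCore, hne, h0, h1, show (m + m) / 2 = m by omega]
  have hg : (decide ((instOf (⟨m + m, 2, C⟩ : KForrelationInstance)).2.1 = 2) && decide ((instOf (⟨m + m, 2, C⟩ : KForrelationInstance)).1 ≤
      (KForrelationInstance.encode ⟨m + m, 2, C⟩).length + 1)) = true := by
    simp only [Bool.and_eq_true, decide_eq_true_eq]
    exact ⟨rfl, hn⟩
  rw [if_pos hg]

/-- Membership in a filter with an explicitly given decidability instance (unification instead of synthesis; registered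
brick `grow_memFilterExpl` of stub `stub_growFinder` — the stub's own statement exceeds the registry's 4000 characters). [folklore] -/
theorem grow_memFilterExpl : ∀ {α : Type} (p : α → Prop) (inst : DecidablePred p) (s : Finset α) (a : α), a ∈ @Finset.filter α p inst s ↔ a ∈ s ∧ p a :=
  fun _ _ _ _ => Finset.mem_filter

end GrowMachine

/-- **Completeness of `growFind`** on the Maiorana–McFarland slice, from the kernel statistics and the closedness of
M-pairs (see the module docstring). [cite: AroraBarak2009, §7.4.1] -/
theorem growFind_complete
    (hK : (∀ (m : ℕ) (C : Fin 2 → Circuit (Fin (m + m))),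
        (⟨m + m, 2, C⟩ : KForrelationInstance).IsOverB2 →
        (∀ i, IsDegLeFun 3 (C i).eval) →
        (forrelation (C 0).eval (C 1).eval = 1 ∨ forrelation (C 0).eval (C 1).eval = -1) →
        (∃ e : (Fin (m + m) → Bool) ≃ (Fin (m + m) → Bool),
          (∃ M : Matrix (Fin (m + m)) (Fin (m + m)) (ZMod 2), ∃ c : Fin (m + m) → ZMod 2,
            ∀ y i, (if e y i then (1 : ZMod 2) else 0) = (M.mulVec (fun j => if y j then (1 : ZMod 2) else 0) + c) i) ∧
          ∃ perm : (Fin m → Bool) ≃ (Fin m → Bool), ∃ h : (Fin m → Bool) → Bool, ∀ y' y'' : Fin m → Bool,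
            (if (C 1).eval (e (Fin.append y' y'')) then (1 : ZMod 2) else 0) =
              (∑ i, (if y' i then (1 : ZMod 2) else 0) * (if perm y'' i then (1 : ZMod 2) else 0)) +
                (if h y'' then (1 : ZMod 2) else 0)) →
        ∀ S U : Finset (Fin (m + m) → Bool),
          (zeroVec ∈ S ∧ ∀ x ∈ S, ∀ y ∈ S, bxor x y ∈ S) → (zeroVec ∈ U ∧ ∀ x ∈ U, ∀ y ∈ U, bxor x y ∈ U) →
          ((∀ s ∈ S, ∀ y : Fin (m + m) → Bool, (fun k => ((C 1).eval zeroVec ^^ (C 1).eval (bxor zeroVec s) ^^ (C 1).eval (bxor zeroVec y) ^^ (C 1).eval (bxor zeroVec (bxor s y))) ^^ ((C 1).eval (fun j => decide (j = k)) ^^ (C 1).eval (bxor (fun j => decide (j = k)) s) ^^ (C 1).eval (bxor (fun j => decide (j = k)) y) ^^ (C 1).eval (bxor (fun j => decide (j = k)) (bxor s y)))) ∈ U) ∧ (∀ s ∈ S, ∃ ℓ ∈ U, ∀ r : Fin (m + m) → Bool, (∀ y z : Fin (m + m) → Bool, (((C 1).eval z ^^ (C 1).eval (bxor z s) ^^ (C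 1).eval (bxor z r) ^^ (C 1).eval (bxor z (bxor s r))) ^^ ((C 1).eval (bxor z y) ^^ (C 1).eval (bxor (bxor z y) s) ^^ (C 1).eval (bxor (bxor z y) r) ^^ (C 1).eval (bxor (bxor z y) (bxor s r)))) = false) → ((C 1).eval r ^^ (C 1).eval (bxor r s) ^^ (C 1).eval zeroVec ^^ (C 1).eval s) = ((Finset.univ.filter fun i => ℓ i && r i).card).bodd)) →
          ((∀ s ∈ U, ∀ y : Fin (m + m) → Bool, (fun k => ((C 0).eval zeroVec ^^ (C 0).eval (bxor zeroVec s) ^^ (C 0).eval (bxor zeroVec y) ^^ (C 0).eval (bxor zeroVec (bxor s y))) ^^ ((C 0).eval (fun j => decide (j = k)) ^^ (C 0).eval (bxor (fun j => decide (j = k)) s) ^^ (C 0).eval (bxor (fun j => decide (j = k)) y) ^^ (C 0).eval (bxor (fun j => decide (j = k)) (bxor s y)))) ∈ S) ∧ (∀ s ∈ U, ∃ ℓ ∈ S, ∀ r : Fin (m + m) → Bool, (∀ y z : Fin (m + m) → Bool, (((C 0).eval z ^^ (C 0).eval (bxor z s) ^^ (C 0).eval (bxor z r) ^^ (C 0).eval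 (bxor z (bxor s r))) ^^ ((C 0).eval (bxor z y) ^^ (C 0).eval (bxor (bxor z y) s) ^^ (C 0).eval (bxor (bxor z y) r) ^^ (C 0).eval (bxor (bxor z y) (bxor s r)))) = false) → ((C 0).eval r ^^ (C 0).eval (bxor r s) ^^ (C 0).eval zeroVec ^^ (C 0).eval s) = ((Finset.univ.filter fun i => ℓ i && r i).card).bodd)) →
          (∀ s ∈ S, ∀ u ∈ U, ((Finset.univ.filter fun i => s i && u i).card).bodd = false) →
          S.card < 2 ^ m → U.card < 2 ^ m →
          (∃ r : ℕ, r ≤ m + m + 1 ∧ (2 : ℝ) ^ ((m + m) * r) / ((m + m + 2 : ℝ) ^ 8) ≤ (∑ xs : Fin (r) → (Fin (m + m) → Bool), (((@Finset.filter (Fin (m + m) → Bool) (fun v => v ∉ S ∧ (∃ V : Finset (Fin (m + m) → Bool), ((zeroVec ∈ V ∧ ∀ x ∈ V, ∀ y ∈ V, bxor x y ∈ V) ∧ (((V).card : ℝ) ^ 2 = (2 : ℝ) ^ (m + m)) ∧ ∀ u ∈ V, ∀ v ∈ V, ∀ x, ((C 1).eval x ^^ (C 1).eval (bxor x u) ^^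 (C 1).eval (bxor x v) ^^ (C 1).eval (bxor x (bxor u v))) = false) ∧ S ⊆ V ∧ v ∈ V ∧ (∀ s ∈ V, ∀ u ∈ U, ((Finset.univ.filter fun i => s i && u i).card).bodd = false))) (Classical.decPred _) (Finset.univ.filter fun (v : Fin (m + m) → Bool) => (∀ s ∈ S, ∀ x, ((C 1).eval x ^^ (C 1).eval (bxor x s) ^^ (C 1).eval (bxor x v) ^^ (C 1).eval (bxor x (bxor s v))) = false) ∧ (∀ u ∈ U, ((Finset.univ.filter fun i => u i && v i).card).bodd = false) ∧ ∀ j, (∀ y z : Fin (m + m) → Bool, (((C 1).eval z ^^ (C 1).eval (bxor z (xs j)) ^^ (C 1).eval (bxor z v) ^^ (C 1).eval (bxor z (bxor (xs j) v))) ^^ ((C 1).eval (bxor z y) ^^ (C 1).eval (bxor (bxor z y) (xs j)) ^^ (C 1).eval (bxor (bxor z y) v) ^^ (C 1).eval (bxor (bxor z y) (bxor (xs j) v)))) = false))).card : ℝ) / (((Finset.univ.filter fun (v : Fin (m + m) → Bool) => (∀ s ∈ S, ∀ x, ((C 1).eval x ^^ (C 1).eval (bxor x s) ^^ (C 1).eval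 (bxor x v) ^^ (C 1).eval (bxor x (bxor s v))) = false) ∧ (∀ u ∈ U, ((Finset.univ.filter fun i => u i && v i).card).bodd = false) ∧ ∀ j, (∀ y z : Fin (m + m) → Bool, (((C 1).eval z ^^ (C 1).eval (bxor z (xs j)) ^^ (C 1).eval (bxor z v) ^^ (C 1).eval (bxor z (bxor (xs j) v))) ^^ ((C 1).eval (bxor z y) ^^ (C 1).eval (bxor (bxor z y) (xs j)) ^^ (C 1).eval (bxor (bxor z y) v) ^^ (C 1).eval (bxor (bxor z y) (bxor (xs j) v)))) = false))).card : ℝ)))) ∨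
          (∃ r : ℕ, r ≤ m + m + 1 ∧ (2 : ℝ) ^ ((m + m) * r) / ((m + m + 2 : ℝ) ^ 8) ≤ (∑ xs : Fin (r) → (Fin (m + m) → Bool), (((@Finset.filter (Fin (m + m) → Bool) (fun v => v ∉ U ∧ (∃ V : Finset (Fin (m + m) → Bool), ((zeroVec ∈ V ∧ ∀ x ∈ V, ∀ y ∈ V, bxor x y ∈ V) ∧ (((V).card : ℝ) ^ 2 = (2 : ℝ) ^ (m + m)) ∧ ∀ u ∈ V, ∀ v ∈ V, ∀ x, ((C 0).eval x ^^ (C 0).eval (bxor x u) ^^ (C 0).eval (bxor x v) ^^ (C 0).eval (bxor x (bxor u v))) = false) ∧ U ⊆ V ∧ v ∈ V ∧ (∀ s ∈ V, ∀ u ∈ S, ((Finset.univ.filter fun i => s i && u i).card).bodd = false))) (Classical.decPred _) (Finset.univ.filter fun (v : Fin (m + m) → Bool) => (∀ s ∈ U, ∀ x, ((C 0).eval x ^^ (C 0).eval (bxor x s) ^^ (C 0).eval (bxor x v) ^^ (C 0).eval (bxor x (bxor s v))) = false) ∧ (∀ u ∈ S, ((Finset.univ.filter fun i => u i && v i).card).bodd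 = false) ∧ ∀ j, (∀ y z : Fin (m + m) → Bool, (((C 0).eval z ^^ (C 0).eval (bxor z (xs j)) ^^ (C 0).eval (bxor z v) ^^ (C 0).eval (bxor z (bxor (xs j) v))) ^^ ((C 0).eval (bxor z y) ^^ (C 0).eval (bxor (bxor z y) (xs j)) ^^ (C 0).eval (bxor (bxor z y) v) ^^ (C 0).eval (bxor (bxor z y) (bxor (xs j) v)))) = false))).card : ℝ) / (((Finset.univ.filter fun (v : Fin (m + m) → Bool) => (∀ s ∈ U, ∀ x, ((C 0).eval x ^^ (C 0).eval (bxor x s) ^^ (C 0).eval (bxor x v) ^^ (C 0).eval (bxor x (bxor s v))) = false) ∧ (∀ u ∈ S, ((Finset.univ.filter fun i => u i && v i).card).bodd = false) ∧ ∀ j, (∀ y z : Fin (m + m) → Bool, (((C 0).eval z ^^ (C 0).eval (bxor z (xs j)) ^^ (C 0).eval (bxor z v) ^^ (C 0).eval (bxor z (bxor (xs j) v))) ^^ ((C 0).eval (bxor z y) ^^ (C 0).eval (bxor (bxor z y) (xs j)) ^^ (C 0).eval (bxor (bxor z y) v) ^^ (C 0).eval (bxor (bxor z y) (bxor (xs j)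 v)))) = false))).card : ℝ))))))
    (hM : (∀ (n : ℕ) (a b : (Fin n → Bool) → Bool) (V : Finset (Fin n → Bool)),
        IsDegLeFun 3 a → IsDegLeFun 3 b → (forrelation a b = 1 ∨ forrelation a b = -1) →
        ((zeroVec ∈ V ∧ ∀ x ∈ V, ∀ y ∈ V, bxor x y ∈ V) ∧ (((V).card : ℝ) ^ 2 = (2 : ℝ) ^ (n)) ∧ ∀ u ∈ V, ∀ v ∈ V, ∀ x, (b x ^^ b (bxor x u) ^^ b (bxor x v) ^^ b (bxor x (bxor u v))) = false) →
        ((∀ s ∈ V, ∀ y : Fin (n) → Bool, (fun k => (b zeroVec ^^ b (bxor zeroVec s) ^^ b (bxor zeroVec y) ^^ b (bxor zeroVec (bxor s y))) ^^ (b (fun j => decide (j = k)) ^^ b (bxor (fun j => decide (j = k)) s) ^^ b (bxor (fun j => decide (j = k)) y) ^^ b (bxor (fun j => decide (j = k)) (bxor s y)))) ∈ (Finset.univ.filter fun (y : Fin (n) → Bool) => ∀ s ∈ V, ((Finset.univ.filter fun i => s i && y i).card).bodd = false)) ∧ (∀ s ∈ V, ∃ ℓ ∈ (Finset.univ.filter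 fun (y : Fin (n) → Bool) => ∀ s ∈ V, ((Finset.univ.filter fun i => s i && y i).card).bodd = false), ∀ r : Fin (n) → Bool, (∀ y z : Fin (n) → Bool, ((b z ^^ b (bxor z s) ^^ b (bxor z r) ^^ b (bxor z (bxor s r))) ^^ (b (bxor z y) ^^ b (bxor (bxor z y) s) ^^ b (bxor (bxor z y) r) ^^ b (bxor (bxor z y) (bxor s r)))) = false) → (b r ^^ b (bxor r s) ^^ b zeroVec ^^ b s) = ((Finset.univ.filter fun i => ℓ i && r i).card).bodd)) ∧
        ((∀ s ∈ (Finset.univ.filter fun (y : Fin (n) → Bool) => ∀ s ∈ V, ((Finset.univ.filter fun i => s i && y i).card).bodd = false), ∀ y : Fin (n) → Bool, (fun k => (a zeroVec ^^ a (bxor zeroVec s) ^^ a (bxor zeroVec y) ^^ a (bxor zeroVec (bxor s y))) ^^ (a (fun j => decide (j = k)) ^^ a (bxor (fun j => decide (j = k)) s) ^^ a (bxor (fun j => decide (j = k)) y) ^^ a (bxor (fun j => decide (j = k)) (bxor s y)))) ∈ V) ∧ (∀ s ∈ (Finset.univ.filter fun (y : Fin (n) → Bool) => ∀ s ∈ V,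 ((Finset.univ.filter fun i => s i && y i).card).bodd = false), ∃ ℓ ∈ V, ∀ r : Fin (n) → Bool, (∀ y z : Fin (n) → Bool, ((a z ^^ a (bxor z s) ^^ a (bxor z r) ^^ a (bxor z (bxor s r))) ^^ (a (bxor z y) ^^ a (bxor (bxor z y) s) ^^ a (bxor (bxor z y) r) ^^ a (bxor (bxor z y) (bxor s r)))) = false) → (a r ^^ a (bxor r s) ^^ a zeroVec ^^ a s) = ((Finset.univ.filter fun i => ℓ i && r i).card).bodd)) ∧
        (∀ s ∈ V, ∀ u ∈ (Finset.univ.filter fun (y : Fin (n) → Bool) => ∀ s ∈ V, ((Finset.univ.filter fun i => s i && y i).card).bodd = false), ((Finset.univ.filter fun i => s i && u i).card).bodd = false)))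
    (m : ℕ) (C : Fin 2 → Circuit (Fin (m + m)))
    (hB2 : (⟨m + m, 2, C⟩ : KForrelationInstance).IsOverB2)
    (hdeg : ∀ i, IsDegLeFun 3 (C i).eval)
    (hΦ : forrelation (C 0).eval (C 1).eval = 1 ∨ forrelation (C 0).eval (C 1).eval = -1)
    (horb : (∃ e : (Fin (m + m) → Bool) ≃ (Fin (m + m) → Bool),
          (∃ M : Matrix (Fin (m + m)) (Fin (m + m)) (ZMod 2), ∃ c : Fin (m + m) → ZMod 2,
            ∀ y i, (if e y i then (1 : ZMod 2) else 0) = (M.mulVec (fun j => if y j then (1 : ZMod 2) else 0) + c) i) ∧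
          ∃ perm : (Fin m → Bool) ≃ (Fin m → Bool), ∃ h : (Fin m → Bool) → Bool, ∀ y' y'' : Fin m → Bool,
            (if (C 1).eval (e (Fin.append y' y'')) then (1 : ZMod 2) else 0) =
              (∑ i, (if y' i then (1 : ZMod 2) else 0) * (if perm y'' i then (1 : ZMod 2) else 0)) +
                (if h y'' then (1 : ZMod 2) else 0))) :
    (2 / 3 : ℝ) ≤ uniformProb ((3 * (Polynomial.X + 1) ^ 2 * (Polynomial.X + 3) ^ 10 : Polynomial ℕ).eval (KForrelationInstance.encode ⟨m + m, 2, C⟩).length)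
      {y | ∃ L : List (List Bool), L ≠ [] ∧ growFind (boolPair (KForrelationInstance.encode ⟨m + m, 2, C⟩) y) = encList L} := by
  -- notation
  set I : KForrelationInstance := ⟨m + m, 2, C⟩ with hI
  set cf : PCirc := pcircOf (C 0) with hcf
  set cg : PCirc := pcircOf (C 1) with hcg
  have hf : ∀ v, evalP cf v = (C 0).eval (toInput (m + m) v) := evalP_pcircOf_eq (C 0)
  have hg : ∀ v, evalP cg v = (C 1).eval (toInput (m + m) v) := evalP_pcircOf_eq (C 1)
  set Df : (Fin (m + m) → Bool) → (Fin (m + m) → Bool) → (Fin (m + m) → Bool) → Bool :=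
    fun u v x => ((C 0).eval x ^^ (C 0).eval (bxor x u) ^^ (C 0).eval (bxor x v) ^^ (C 0).eval (bxor x (bxor u v))) with hDf'
  set Dg : (Fin (m + m) → Bool) → (Fin (m + m) → Bool) → (Fin (m + m) → Bool) → Bool :=
    fun u v x => ((C 1).eval x ^^ (C 1).eval (bxor x u) ^^ (C 1).eval (bxor x v) ^^ (C 1).eval (bxor x (bxor u v))) with hDg'
  have hDf : ∀ u v x, Df u v x = ((C 0).eval x ^^ (C 0).eval (bxor x u) ^^ (C 0).eval (bxor x v) ^^ (C 0).eval (bxor x (bxor u v))) := fun _ _ _ => rfl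
  have hDg : ∀ u v x, Dg u v x = ((C 1).eval x ^^ (C 1).eval (bxor x u) ^^ (C 1).eval (bxor x v) ^^ (C 1).eval (bxor x (bxor u v))) := fun _ _ _ => rfl
  set Clf : Finset (Fin (m + m) → Bool) → Finset (Fin (m + m) → Bool) → Prop := fun A B =>
    ((∀ s ∈ A, ∀ y : Fin (m + m) → Bool, (fun k => (Df s y zeroVec ^^ Df s y (fun j => decide (j = k)))) ∈ B) ∧
     (∀ s ∈ A, ∃ ℓ ∈ B, ∀ r : Fin (m + m) → Bool, (∀ y z : Fin (m + m) → Bool, (Df s r z ^^ Df s r (bxor z y)) = false) →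
        Df s r zeroVec = (univ.filter fun i => ℓ i && r i).card.bodd)) with hClf'
  set Clg : Finset (Fin (m + m) → Bool) → Finset (Fin (m + m) → Bool) → Prop := fun A B =>
    ((∀ s ∈ A, ∀ y : Fin (m + m) → Bool, (fun k => (Dg s y zeroVec ^^ Dg s y (fun j => decide (j = k)))) ∈ B) ∧
     (∀ s ∈ A, ∃ ℓ ∈ B, ∀ r : Fin (m + m) → Bool, (∀ y z : Fin (m + m) → Bool, (Dg s r z ^^ Dg s r (bxor z y)) = false) →
        Dg s r zeroVec = (univ.filter fun i => ℓ i && r i).card.bodd)) with hClg'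
  have hClf : ∀ A B, Clf A B ↔
    ((∀ s ∈ A, ∀ y : Fin (m + m) → Bool, (fun k => (Df s y zeroVec ^^ Df s y (fun j => decide (j = k)))) ∈ B) ∧
     (∀ s ∈ A, ∃ ℓ ∈ B, ∀ r : Fin (m + m) → Bool, (∀ y z : Fin (m + m) → Bool, (Df s r z ^^ Df s r (bxor z y)) = false) →
        Df s r zeroVec = (univ.filter fun i => ℓ i && r i).card.bodd)) := fun _ _ => Iff.rfl
  have hClg : ∀ A B, Clg A B ↔
    ((∀ s ∈ A, ∀ y : Fin (m + m) → Bool, (fun k => (Dg s y zeroVec ^^ Dg s y (fun j => decide (j = k)))) ∈ B) ∧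
     (∀ s ∈ A, ∃ ℓ ∈ B, ∀ r : Fin (m + m) → Bool, (∀ y z : Fin (m + m) → Bool, (Dg s r z ^^ Dg s r (bxor z y)) = false) →
        Dg s r zeroVec = (univ.filter fun i => ℓ i && r i).card.bodd)) := fun _ _ => Iff.rfl
  set Inv : Mat × Mat → Prop := fun p =>
    ((spanV (m + m) p.1).card = 2 ^ p.1.length ∧ (spanV (m + m) p.2).card = 2 ^ p.2.length) ∧ (p.1.length ≤ m ∧ p.2.length ≤ m) ∧
      Clg (spanV (m + m) p.1) (spanV (m + m) p.2) ∧ Clf (spanV (m + m) p.2) (spanV (m + m) p.1) ∧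
      ∀ s ∈ spanV (m + m) p.1, ∀ u ∈ spanV (m + m) p.2, (univ.filter fun i => s i && u i).card.bodd = false with hInv'
  have hInv : ∀ p, Inv p ↔
    ((spanV (m + m) p.1).card = 2 ^ p.1.length ∧ (spanV (m + m) p.2).card = 2 ^ p.2.length) ∧ (p.1.length ≤ m ∧ p.2.length ≤ m) ∧
      Clg (spanV (m + m) p.1) (spanV (m + m) p.2) ∧ Clf (spanV (m + m) p.2) (spanV (m + m) p.1) ∧
      ∀ s ∈ spanV (m + m) p.1, ∀ u ∈ spanV (m + m) p.2, (univ.filter fun i => s i && u i).card.bodd = false := fun _ => Iff.rfl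
  have hf3 : IsDegLeFun 3 (C 0).eval := hdeg 0
  have hg3 : IsDegLeFun 3 (C 1).eval := hdeg 1
  have hΦ' : forrelation (C 1).eval (C 0).eval = 1 ∨ forrelation (C 1).eval (C 0).eval = -1 := by
    rw [forrelation_symm']; exact hΦ
  -- the closedness of M-pairs, both sides
  have hMPg : ∀ V : Finset (Fin (m + m) → Bool),
      ((zeroVec ∈ V ∧ ∀ x ∈ V, ∀ y ∈ V, bxor x y ∈ V) ∧ (((V.card : ℝ)) ^ 2 = (2 : ℝ) ^ (m + m)) ∧ ∀ u ∈ V, ∀ v ∈ V, ∀ x, Dg u v x = false) →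
        Clg V (univ.filter fun y : Fin (m + m) → Bool => ∀ s ∈ V, (univ.filter fun i => s i && y i).card.bodd = false) ∧
        Clf (univ.filter fun y : Fin (m + m) → Bool => ∀ s ∈ V, (univ.filter fun i => s i && y i).card.bodd = false) V := by
    intro V hV
    obtain ⟨hb, ha, -⟩ := hM (m + m) (C 0).eval (C 1).eval V hf3 hg3 hΦ hV
    exact ⟨(hClg _ _).2 ⟨hb.1, offs_Dform Dg hDg hb.2⟩, (hClf _ _).2 ⟨ha.1, offs_Dform Df hDf ha.2⟩⟩
  have hMPf : ∀ V : Finset (Fin (m + m) → Bool),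
      ((zeroVec ∈ V ∧ ∀ x ∈ V, ∀ y ∈ V, bxor x y ∈ V) ∧ (((V.card : ℝ)) ^ 2 = (2 : ℝ) ^ (m + m)) ∧ ∀ u ∈ V, ∀ v ∈ V, ∀ x, Df u v x = false) →
        Clf V (univ.filter fun y : Fin (m + m) → Bool => ∀ s ∈ V, (univ.filter fun i => s i && y i).card.bodd = false) ∧
        Clg (univ.filter fun y : Fin (m + m) → Bool => ∀ s ∈ V, (univ.filter fun i => s i && y i).card.bodd = false) V := by
    intro V hV
    obtain ⟨hb, ha, -⟩ := hM (m + m) (C 1).eval (C 0).eval V hg3 hf3 hΦ' hV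
    exact ⟨(hClf _ _).2 ⟨hb.1, offs_Dform Df hDf hb.2⟩, (hClg _ _).2 ⟨ha.1, offs_Dform Dg hDg ha.2⟩⟩
  -- the abstract stage lemma, instantiated
  set CC := chunkLen (m + m) with hCC
  set T' := 3 * (m + m + 2) ^ 9 with hT'
  set run : ℕ → List Bool → Mat × Mat := fun k y =>
    (List.range k).foldl (fun p t => trialC (m + m) m cf cg p ((y.drop (t * CC)).take CC)) ([], []) with hrun
  have h0 : Inv ([], []) :=
    ⟨⟨card_spanV_nil, card_spanV_nil⟩, ⟨Nat.zero_le _, Nat.zero_le _⟩, closedChk_sound Dg hDg hg hg3 Clg hClg (closedChk_nil cg []),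
      closedChk_sound Df hDf hf hf3 Clf hClf (closedChk_nil cf []), (orthChk_eq_true_iff [] []).1 orthChk_nil⟩
  have hstep : ∀ s c, Inv s → Inv (trialC (m + m) m cf cg s c) ∧ (trialC (m + m) m cf cg s c = s ∨
      s.1.length + s.2.length + 1 ≤ (trialC (m + m) m cf cg s c).1.length + (trialC (m + m) m cf cg s c).2.length) :=
    fun s c hs => trialC_sound Df Dg hDf hDg hf hg hf3 hg3 Clf Clg hClf hClg Inv hInv hs c
  have hterm : ∀ s c, terminal m s = true → trialC (m + m) m cf cg s c = s := fun s c ht => trialC_of_terminal ht c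
  have hpot : ∀ s, Inv s → terminal m s = false → s.1.length + s.2.length < m + m := by
    intro s hs ht
    obtain ⟨-, ⟨hl1, hl2⟩, -⟩ := hs
    simp only [terminal, Bool.or_eq_false_iff, decide_eq_false_iff_not] at ht
    omega
  -- a trial changes a non-terminal state with probability `≥ (n+2)⁻⁸`
  have hprob : ∀ s, Inv s → terminal m s = false →
      uniformProb CC {c | trialC (m + m) m cf cg s c = s} ≤ 1 - 1 / (((m + m : ℕ) : ℝ) + 2) ^ 8 := by
    intro s hs ht
    obtain ⟨⟨hb1, hb2⟩, ⟨hl1, hl2⟩, hcg', hcf', ho⟩ := (hInv s).1 hs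
    simp only [terminal, Bool.or_eq_false_iff, decide_eq_false_iff_not] at ht
    have hSlt : (spanV (m + m) s.1).card < 2 ^ m := by rw [hb1]; exact Nat.pow_lt_pow_right (by norm_num) (by omega)
    have hUlt : (spanV (m + m) s.2).card < 2 ^ m := by rw [hb2]; exact Nat.pow_lt_pow_right (by norm_num) (by omega)
    have hKS := hK m C hB2 hdeg hΦ horb (spanV (m + m) s.1) (spanV (m + m) s.2)
      ⟨zeroVec_mem_spanV _, fun _ hx _ hy => bxor_mem_spanV hx hy⟩ ⟨zeroVec_mem_spanV _, fun _ hx _ hy => bxor_mem_spanV hx hy⟩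
      ⟨hcg'.1, offs_fform Dg hDg hcg'.2⟩ ⟨hcf'.1, offs_fform Df hDf hcf'.2⟩ ho hSlt hUlt
    -- the change event has probability `≥ (n+2)⁻⁸`
    have hchange : 1 / (((m + m : ℕ) : ℝ) + 2) ^ 8 ≤ uniformProb CC {c | trialC (m + m) m cf cg s c ≠ s} := by
      have hcast : (((m + m : ℕ) : ℝ) + 2) = (m + m + 2 : ℝ) := by push_cast; ring
      rcases hKS with ⟨r, hr, hmass⟩ | ⟨r, hr, hmass⟩
      · -- the `b`-side
        set Gd : Finset (Fin (m + m) → Bool) := @Finset.filter (Fin (m + m) → Bool) (fun v => v ∉ spanV (m + m) s.1 ∧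
          (∃ V : Finset (Fin (m + m) → Bool), ((zeroVec ∈ V ∧ ∀ x ∈ V, ∀ y ∈ V, bxor x y ∈ V) ∧ (((V).card : ℝ) ^ 2 = (2 : ℝ) ^ (m + m)) ∧
            ∀ u ∈ V, ∀ v ∈ V, ∀ x, ((C 1).eval x ^^ (C 1).eval (bxor x u) ^^ (C 1).eval (bxor x v) ^^ (C 1).eval (bxor x (bxor u v))) = false) ∧
            spanV (m + m) s.1 ⊆ V ∧ v ∈ V ∧ (∀ s' ∈ V, ∀ u ∈ spanV (m + m) s.2, ((Finset.univ.filter fun i => s' i && u i).card).bodd = false)))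
          (Classical.decPred _) univ with hGd'
        have hGd : ∀ v, v ∈ Gd ↔ v ∉ spanV (m + m) s.1 ∧ ∃ V : Finset (Fin (m + m) → Bool),
            ((zeroVec ∈ V ∧ ∀ x ∈ V, ∀ y ∈ V, bxor x y ∈ V) ∧ (((V.card : ℝ)) ^ 2 = (2 : ℝ) ^ (m + m)) ∧ ∀ u ∈ V, ∀ v ∈ V, ∀ x, Dg u v x = false) ∧
            spanV (m + m) s.1 ⊆ V ∧ v ∈ V ∧ ∀ s' ∈ V, ∀ u ∈ spanV (m + m) s.2, (univ.filter fun i => s' i && u i).card.bodd = false := by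
          intro v; exact ⟨fun h => ((grow_memFilterExpl _ _ _ _).1 h).2, fun h => (grow_memFilterExpl _ _ _ _).2 ⟨mem_univ _, h⟩⟩
        set Kx : (Fin r → (Fin (m + m) → Bool)) → Finset (Fin (m + m) → Bool) := fun xs =>
          Finset.univ.filter fun (v : Fin (m + m) → Bool) => (∀ s' ∈ spanV (m + m) s.1, ∀ x, ((C 1).eval x ^^ (C 1).eval (bxor x s') ^^ (C 1).eval (bxor x v) ^^ (C 1).eval (bxor x (bxor s' v))) = false) ∧
            (∀ u ∈ spanV (m + m) s.2, ((Finset.univ.filter fun i => u i && v i).card).bodd = false) ∧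
            ∀ j, (∀ y z : Fin (m + m) → Bool, (((C 1).eval z ^^ (C 1).eval (bxor z (xs j)) ^^ (C 1).eval (bxor z v) ^^ (C 1).eval (bxor z (bxor (xs j) v))) ^^ ((C 1).eval (bxor z y) ^^ (C 1).eval (bxor (bxor z y) (xs j)) ^^ (C 1).eval (bxor (bxor z y) v) ^^ (C 1).eval (bxor (bxor z y) (bxor (xs j) v)))) = false)
          with hKx'
        have hKx : ∀ xs v, v ∈ Kx xs ↔ (∀ s' ∈ spanV (m + m) s.1, ∀ x, Dg s' v x = false) ∧
            (∀ u ∈ spanV (m + m) s.2, (univ.filter fun i => u i && v i).card.bodd = false) ∧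
            ∀ j, ∀ y z : Fin (m + m) → Bool, (Dg (xs j) v z ^^ Dg (xs j) v (bxor z y)) = false := by
          intro xs v; exact ⟨fun h => (Finset.mem_filter.1 h).2, fun h => Finset.mem_filter.2 ⟨mem_univ _, h⟩⟩
        have hfilt : ∀ xs, (Kx xs).filter (fun v => v ∈ Gd) = @Finset.filter (Fin (m + m) → Bool) (fun v => v ∉ spanV (m + m) s.1 ∧
          (∃ V : Finset (Fin (m + m) → Bool), ((zeroVec ∈ V ∧ ∀ x ∈ V, ∀ y ∈ V, bxor x y ∈ V) ∧ (((V).card : ℝ) ^ 2 = (2 : ℝ) ^ (m + m)) ∧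
            ∀ u ∈ V, ∀ v ∈ V, ∀ x, ((C 1).eval x ^^ (C 1).eval (bxor x u) ^^ (C 1).eval (bxor x v) ^^ (C 1).eval (bxor x (bxor u v))) = false) ∧
            spanV (m + m) s.1 ⊆ V ∧ v ∈ V ∧ (∀ s' ∈ V, ∀ u ∈ spanV (m + m) s.2, ((Finset.univ.filter fun i => s' i && u i).card).bodd = false)))
          (Classical.decPred _) (Kx xs) := by
          intro xs; ext v
          exact ⟨fun h => (grow_memFilterExpl _ _ _ _).2 ⟨(Finset.mem_filter.1 h).1, ((grow_memFilterExpl _ _ _ _).1 (Finset.mem_filter.1 h).2).2⟩,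
            fun h => Finset.mem_filter.2 ⟨((grow_memFilterExpl _ _ _ _).1 h).1, (grow_memFilterExpl _ _ _ _).2 ⟨mem_univ _, ((grow_memFilterExpl _ _ _ _).1 h).2⟩⟩⟩
        have hmass' : (2 : ℝ) ^ ((m + m) * r) / (((m + m : ℕ) : ℝ) + 2) ^ 8 ≤
            ∑ xs : Fin r → (Fin (m + m) → Bool), (((Kx xs).filter fun v => v ∈ Gd).card : ℝ) / (Kx xs).card := by
          rw [hcast]
          refine hmass.trans (le_of_eq (Finset.sum_congr rfl fun xs _ => ?_))
          rw [hfilt xs]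
        have hge := uniformProb_tryB_ge Df Dg hDf hDg hf hg hf3 hg3 Clf Clg hClf hClg Inv hInv hMPg rfl hs hr Gd hGd Kx hKx hmass'
        refine hge.trans (uniformProb_mono_of_length' fun c _ hc => ?_)
        obtain ⟨q, hq⟩ := hc
        refine trialC_ne_self Df Dg hDf hDg hf hg hf3 hg3 Clf Clg hClf hClg Inv hInv hs (by simp [terminal, ht.1, ht.2]) (j := 2 * r) (by omega) ⟨q, ?_⟩
        rw [tryJob, if_pos (by simp), Nat.mul_div_cancel_left r (by norm_num)]
        exact hq
      · -- the `a`-side (the `b`-side of the swapped pair)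
        set Gd : Finset (Fin (m + m) → Bool) := @Finset.filter (Fin (m + m) → Bool) (fun v => v ∉ spanV (m + m) s.2 ∧
          (∃ V : Finset (Fin (m + m) → Bool), ((zeroVec ∈ V ∧ ∀ x ∈ V, ∀ y ∈ V, bxor x y ∈ V) ∧ (((V).card : ℝ) ^ 2 = (2 : ℝ) ^ (m + m)) ∧
            ∀ u ∈ V, ∀ v ∈ V, ∀ x, ((C 0).eval x ^^ (C 0).eval (bxor x u) ^^ (C 0).eval (bxor x v) ^^ (C 0).eval (bxor x (bxor u v))) = false) ∧
            spanV (m + m) s.2 ⊆ V ∧ v ∈ V ∧ (∀ s' ∈ V, ∀ u ∈ spanV (m + m) s.1, ((Finset.univ.filter fun i => s' i && u i).card).bodd = false)))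
          (Classical.decPred _) univ with hGd'
        have hGd : ∀ v, v ∈ Gd ↔ v ∉ spanV (m + m) s.swap.1 ∧ ∃ V : Finset (Fin (m + m) → Bool),
            ((zeroVec ∈ V ∧ ∀ x ∈ V, ∀ y ∈ V, bxor x y ∈ V) ∧ (((V.card : ℝ)) ^ 2 = (2 : ℝ) ^ (m + m)) ∧ ∀ u ∈ V, ∀ v ∈ V, ∀ x, Df u v x = false) ∧
            spanV (m + m) s.swap.1 ⊆ V ∧ v ∈ V ∧ ∀ s' ∈ V, ∀ u ∈ spanV (m + m) s.swap.2, (univ.filter fun i => s' i && u i).card.bodd = false := by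
          intro v; exact ⟨fun h => ((grow_memFilterExpl _ _ _ _).1 h).2, fun h => (grow_memFilterExpl _ _ _ _).2 ⟨mem_univ _, h⟩⟩
        set Kx : (Fin r → (Fin (m + m) → Bool)) → Finset (Fin (m + m) → Bool) := fun xs =>
          Finset.univ.filter fun (v : Fin (m + m) → Bool) => (∀ s' ∈ spanV (m + m) s.2, ∀ x, ((C 0).eval x ^^ (C 0).eval (bxor x s') ^^ (C 0).eval (bxor x v) ^^ (C 0).eval (bxor x (bxor s' v))) = false) ∧
            (∀ u ∈ spanV (m + m) s.1, ((Finset.univ.filter fun i => u i && v i).card).bodd = false) ∧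
            ∀ j, (∀ y z : Fin (m + m) → Bool, (((C 0).eval z ^^ (C 0).eval (bxor z (xs j)) ^^ (C 0).eval (bxor z v) ^^ (C 0).eval (bxor z (bxor (xs j) v))) ^^ ((C 0).eval (bxor z y) ^^ (C 0).eval (bxor (bxor z y) (xs j)) ^^ (C 0).eval (bxor (bxor z y) v) ^^ (C 0).eval (bxor (bxor z y) (bxor (xs j) v)))) = false)
          with hKx'
        have hKx : ∀ xs v, v ∈ Kx xs ↔ (∀ s' ∈ spanV (m + m) s.swap.1, ∀ x, Df s' v x = false) ∧
            (∀ u ∈ spanV (m + m) s.swap.2, (univ.filter fun i => u i && v i).card.bodd = false) ∧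
            ∀ j, ∀ y z : Fin (m + m) → Bool, (Df (xs j) v z ^^ Df (xs j) v (bxor z y)) = false := by
          intro xs v; exact ⟨fun h => (Finset.mem_filter.1 h).2, fun h => Finset.mem_filter.2 ⟨mem_univ _, h⟩⟩
        have hfilt : ∀ xs, (Kx xs).filter (fun v => v ∈ Gd) = @Finset.filter (Fin (m + m) → Bool) (fun v => v ∉ spanV (m + m) s.2 ∧
          (∃ V : Finset (Fin (m + m) → Bool), ((zeroVec ∈ V ∧ ∀ x ∈ V, ∀ y ∈ V, bxor x y ∈ V) ∧ (((V).card : ℝ) ^ 2 = (2 : ℝ) ^ (m + m)) ∧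
            ∀ u ∈ V, ∀ v ∈ V, ∀ x, ((C 0).eval x ^^ (C 0).eval (bxor x u) ^^ (C 0).eval (bxor x v) ^^ (C 0).eval (bxor x (bxor u v))) = false) ∧
            spanV (m + m) s.2 ⊆ V ∧ v ∈ V ∧ (∀ s' ∈ V, ∀ u ∈ spanV (m + m) s.1, ((Finset.univ.filter fun i => s' i && u i).card).bodd = false)))
          (Classical.decPred _) (Kx xs) := by
          intro xs; ext v
          exact ⟨fun h => (grow_memFilterExpl _ _ _ _).2 ⟨(Finset.mem_filter.1 h).1, ((grow_memFilterExpl _ _ _ _).1 (Finset.mem_filter.1 h).2).2⟩,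
            fun h => Finset.mem_filter.2 ⟨((grow_memFilterExpl _ _ _ _).1 h).1, (grow_memFilterExpl _ _ _ _).2 ⟨mem_univ _, ((grow_memFilterExpl _ _ _ _).1 h).2⟩⟩⟩
        have hmass' : (2 : ℝ) ^ ((m + m) * r) / (((m + m : ℕ) : ℝ) + 2) ^ 8 ≤
            ∑ xs : Fin r → (Fin (m + m) → Bool), (((Kx xs).filter fun v => v ∈ Gd).card : ℝ) / (Kx xs).card := by
          rw [hcast]
          refine hmass.trans (le_of_eq (Finset.sum_congr rfl fun xs _ => ?_))
          rw [hfilt xs]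
        have hs' : (fun q : Mat × Mat => Inv q.swap) s.swap := by show Inv s.swap.swap; rw [Prod.swap_swap]; exact hs
        have hge := uniformProb_tryB_ge Dg Df hDg hDf hg hf hg3 hf3 Clg Clf hClg hClf (fun q : Mat × Mat => Inv q.swap)
          (hInv_swap Clf Clg Inv hInv) hMPf rfl hs' hr Gd hGd Kx hKx hmass'
        refine hge.trans (uniformProb_mono_of_length' fun c _ hc => ?_)
        obtain ⟨q, hq⟩ := hc
        refine trialC_ne_self Df Dg hDf hDg hf hg hf3 hg3 Clf Clg hClf hClg Inv hInv hs (by simp [terminal, ht.1, ht.2]) (j := 2 * r + 1) (by omega) ⟨q.swap, ?_⟩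
        rw [tryJob, if_neg (by simp), show (2 * r + 1) / 2 = r by omega, tryA, hq]
        rfl
    -- complement
    have hcompl : {c : List Bool | trialC (m + m) m cf cg s c = s} = {c | trialC (m + m) m cf cg s c ≠ s}ᶜ := by
      ext c; simp
    rw [hcompl, Literature.Computability.Complexity.uniformProb_compl]
    linarith
  have hθ : (0 : ℝ) ≤ 1 - 1 / (((m + m : ℕ) : ℝ) + 2) ^ 8 := by
    rw [sub_nonneg, div_le_one (by positivity)]
    exact one_le_pow₀ (by linarith [(m + m).cast_nonneg (α := ℝ)])
  have hfail := uniformProb_not_term_le (trialC (m + m) m cf cg) (fun p => p.1.length + p.2.length) (terminal m) Inv CC T' (m + m) ([], [])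
    run (fun _ => rfl) (fun k y => run_succ _ _ CC k y) h0 hstep hterm hpot hθ hprob
  -- the size guard and the value of the machine
  have hnle : m + m ≤ I.encode.length + 1 :=
    Plumbing.n_le_of_value I rfl (by rw [hI, KForrelationInstance.value_mk_two]; exact hΦ)
  have hcore : ∀ y, growCore (instOf I) I.encode.length y = outCtx (m + m) m cf cg y := fun y => growCore_mk_two m C hnle y
  -- a terminal final state gives a non-empty output
  have hInvRun : ∀ y, Inv (runY (m + m) m cf cg y) := fun y =>
    foldl_inv Inv _ (fun s t hs => (hstep s _ hs).1) _ _ h0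
  have hsub : ∀ y : List Bool, terminal m (runY (m + m) m cf cg y) = true →
      ∃ L : List (List Bool), L ≠ [] ∧ growFind (boolPair I.encode y) = encList L := by
    intro y hty
    have hcert : certOK (m + m) cg (rowsOut (m + m) m (runY (m + m) m cf cg y)) = true :=
      certOK_rowsOut Df Dg hDf hDg hg hf3 hg3 Clf Clg hClf hClg Inv hInv rfl hΦ' (hInvRun y) hty
    refine ⟨rowsOut (m + m) m (runY (m + m) m cf cg y), List.cons_ne_nil _ _, ?_⟩
    rw [growFind_encode, hcore, outCtx, if_pos hcert]
  -- probability bookkeeping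
  set M := (3 * (Polynomial.X + 1) ^ 2 * (Polynomial.X + 3) ^ 10 : Polynomial ℕ).eval I.encode.length with hM'
  have htot : numTrials (m + m) * chunkLen (m + m) ≤ M := total_le_growPoly hnle
  have hset : {y : List Bool | terminal m (runY (m + m) m cf cg y) = false} =
      {y | y.take (numTrials (m + m) * chunkLen (m + m)) ∈ {w : List Bool | terminal m (runY (m + m) m cf cg w) = false}} :=
    Set.ext fun y => by simp only [Set.mem_setOf_eq]; rw [runY_take]
  have hNT : numTrials (m + m) = (m + m) * T' := by unfold numTrials; rw [hT']
  have hrunY : ∀ w : List Bool, w.length = numTrials (m + m) * chunkLen (m + m) → runY (m + m) m cf cg w = run (numTrials (m + m)) w :=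
    fun w hw => runY_eq_run (m + m) m cf cg hw
  have hstep0 := uniformProb_take_of_le htot {w : List Bool | terminal m (runY (m + m) m cf cg w) = false}
  have hstep1 : uniformProb M {y | terminal m (runY (m + m) m cf cg y) = false} =
      uniformProb (numTrials (m + m) * chunkLen (m + m)) {w | terminal m (runY (m + m) m cf cg w) = false} := by
    rw [← hstep0]; exact congrArg (uniformProb M) hset
  have hstep2 : uniformProb (numTrials (m + m) * chunkLen (m + m)) {w | terminal m (runY (m + m) m cf cg w) = false} ≤
      uniformProb (numTrials (m + m) * chunkLen (m + m)) {w | terminal m (run (numTrials (m + m)) w) = false} :=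
    uniformProb_mono_of_length' fun w hw h => by
      have h' : terminal m (runY (m + m) m cf cg w) = false := h
      rw [hrunY w hw] at h'
      exact h'
  have hstep3 : uniformProb (numTrials (m + m) * chunkLen (m + m)) {w | terminal m (run (numTrials (m + m)) w) = false} ≤
      (m + m : ℕ) * (1 - 1 / (((m + m : ℕ) : ℝ) + 2) ^ 8) ^ T' := by
    rw [hNT, Nat.mul_assoc, ← hCC]; exact hfail
  have hfailM : uniformProb M {y | terminal m (runY (m + m) m cf cg y) = false} ≤ 1 / 3 := by
    rw [hstep1]
    exact hstep2.trans (hstep3.trans (stage_bound (m + m)))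
  have hcomplM : {y : List Bool | terminal m (runY (m + m) m cf cg y) = true} = {y | terminal m (runY (m + m) m cf cg y) = false}ᶜ := by
    ext y; simp
  calc (2 / 3 : ℝ) ≤ uniformProb M {y | terminal m (runY (m + m) m cf cg y) = true} := by
        rw [hcomplM, Literature.Computability.Complexity.uniformProb_compl]; linarith
    _ ≤ _ := uniformProb_mono_of_length' fun y _ hy => hsub y hy

/-- **The GROW machine** (stub `stub_growFinder` of line `dual-pingpong-frame`, crux stmt-QuantumAdvantage-13932): the line's
KERNEL STATISTICS and the closedness of M-pairs (`MPairClosed`) yield a coin finder on the Maiorana–McFarland slice —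
`growFind ∈ FP` (file III), SOUND on every coin string (`growFind_sound`: a non-empty output spans an M-subspace of
`b = C₁`) and COMPLETE with probability `≥ 2/3` with `3 (ℓ+1)² (ℓ+3)¹⁰` coins (`growFind_complete`).
[cite: AroraBarak2009, §7.4.1] -/
theorem stub_growFinder :
    (∀ (m : ℕ) (C : Fin 2 → Circuit (Fin (m + m))),
        (⟨m + m, 2, C⟩ : KForrelationInstance).IsOverB2 →
        (∀ i, IsDegLeFun 3 (C i).eval) →
        (forrelation (C 0).eval (C 1).eval = 1 ∨ forrelation (C 0).eval (C 1).eval = -1) →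
        (∃ e : (Fin (m + m) → Bool) ≃ (Fin (m + m) → Bool),
          (∃ M : Matrix (Fin (m + m)) (Fin (m + m)) (ZMod 2), ∃ c : Fin (m + m) → ZMod 2,
            ∀ y i, (if e y i then (1 : ZMod 2) else 0) = (M.mulVec (fun j => if y j then (1 : ZMod 2) else 0) + c) i) ∧
          ∃ perm : (Fin m → Bool) ≃ (Fin m → Bool), ∃ h : (Fin m → Bool) → Bool, ∀ y' y'' : Fin m → Bool,
            (if (C 1).eval (e (Fin.append y' y'')) then (1 : ZMod 2) else 0) =
              (∑ i, (if y' i then (1 : ZMod 2) else 0) * (if perm y'' i then (1 : ZMod 2) else 0)) +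
                (if h y'' then (1 : ZMod 2) else 0)) →
        ∀ S U : Finset (Fin (m + m) → Bool),
          (zeroVec ∈ S ∧ ∀ x ∈ S, ∀ y ∈ S, bxor x y ∈ S) → (zeroVec ∈ U ∧ ∀ x ∈ U, ∀ y ∈ U, bxor x y ∈ U) →
          ((∀ s ∈ S, ∀ y : Fin (m + m) → Bool, (fun k => ((C 1).eval zeroVec ^^ (C 1).eval (bxor zeroVec s) ^^ (C 1).eval (bxor zeroVec y) ^^ (C 1).eval (bxor zeroVec (bxor s y))) ^^ ((C 1).eval (fun j => decide (j = k)) ^^ (C 1).eval (bxor (fun j => decide (j = k)) s) ^^ (C 1).eval (bxor (fun j => decide (j = k)) y) ^^ (C 1).eval (bxor (fun j => decide (j = k)) (bxor s y)))) ∈ U) ∧ (∀ s ∈ S, ∃ ℓ ∈ U, ∀ r : Fin (m + m) → Bool, (∀ y z : Fin (m + m) → Bool, (((C 1).eval z ^^ (C 1).eval (bxor z s) ^^ (C 1).eval (bxor z r) ^^ (C 1).eval (bxor z (bxor s r))) ^^ ((C 1).eval (bxor z y) ^^ (C 1).eval (bxor (bxor z y) s) ^^ (C 1).eval (bxor (bxor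 z y) r) ^^ (C 1).eval (bxor (bxor z y) (bxor s r)))) = false) → ((C 1).eval r ^^ (C 1).eval (bxor r s) ^^ (C 1).eval zeroVec ^^ (C 1).eval s) = ((Finset.univ.filter fun i => ℓ i && r i).card).bodd)) →
          ((∀ s ∈ U, ∀ y : Fin (m + m) → Bool, (fun k => ((C 0).eval zeroVec ^^ (C 0).eval (bxor zeroVec s) ^^ (C 0).eval (bxor zeroVec y) ^^ (C 0).eval (bxor zeroVec (bxor s y))) ^^ ((C 0).eval (fun j => decide (j = k)) ^^ (C 0).eval (bxor (fun j => decide (j = k)) s) ^^ (C 0).eval (bxor (fun j => decide (j = k)) y) ^^ (C 0).eval (bxor (fun j => decide (j = k)) (bxor s y)))) ∈ S) ∧ (∀ s ∈ U, ∃ ℓ ∈ S, ∀ r : Fin (m + m) → Bool, (∀ y z : Fin (m + m) → Bool, (((C 0).eval z ^^ (C 0).eval (bxor z s) ^^ (C 0).eval (bxor z r) ^^ (C 0).eval (bxor z (bxor s r))) ^^ ((C 0).eval (bxor z y) ^^ (C 0).eval (bxor (bxor z y) s) ^^ (C 0).eval (bxor (bxor z y) r) ^^ (C 0).eval (bxor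 (bxor z y) (bxor s r)))) = false) → ((C 0).eval r ^^ (C 0).eval (bxor r s) ^^ (C 0).eval zeroVec ^^ (C 0).eval s) = ((Finset.univ.filter fun i => ℓ i && r i).card).bodd)) →
          (∀ s ∈ S, ∀ u ∈ U, ((Finset.univ.filter fun i => s i && u i).card).bodd = false) →
          S.card < 2 ^ m → U.card < 2 ^ m →
          (∃ r : ℕ, r ≤ m + m + 1 ∧ (2 : ℝ) ^ ((m + m) * r) / ((m + m + 2 : ℝ) ^ 8) ≤ (∑ xs : Fin (r) → (Fin (m + m) → Bool), (((@Finset.filter (Fin (m + m) → Bool) (fun v => v ∉ S ∧ (∃ V : Finset (Fin (m + m) → Bool), ((zeroVec ∈ V ∧ ∀ x ∈ V, ∀ y ∈ V, bxor x y ∈ V) ∧ (((V).card : ℝ) ^ 2 = (2 : ℝ) ^ (m + m)) ∧ ∀ u ∈ V, ∀ v ∈ V, ∀ x, ((C 1).eval x ^^ (C 1).eval (bxor x u) ^^ (C 1).eval (bxor x v) ^^ (C 1).eval (bxor x (bxor u v))) = false) ∧ S ⊆ V ∧ v ∈ V ∧ (∀ s ∈ V, ∀ u ∈ U, ((Finset.univ.filter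 fun i => s i && u i).card).bodd = false))) (Classical.decPred _) (Finset.univ.filter fun (v : Fin (m + m) → Bool) => (∀ s ∈ S, ∀ x, ((C 1).eval x ^^ (C 1).eval (bxor x s) ^^ (C 1).eval (bxor x v) ^^ (C 1).eval (bxor x (bxor s v))) = false) ∧ (∀ u ∈ U, ((Finset.univ.filter fun i => u i && v i).card).bodd = false) ∧ ∀ j, (∀ y z : Fin (m + m) → Bool, (((C 1).eval z ^^ (C 1).eval (bxor z (xs j)) ^^ (C 1).eval (bxor z v) ^^ (C 1).eval (bxor z (bxor (xs j) v))) ^^ ((C 1).eval (bxor z y) ^^ (C 1).eval (bxor (bxor z y) (xs j)) ^^ (C 1).eval (bxor (bxor z y) v) ^^ (C 1).eval (bxor (bxor z y) (bxor (xs j) v)))) = false))).card : ℝ) / (((Finset.univ.filter fun (v : Fin (m + m) → Bool) => (∀ s ∈ S, ∀ x, ((C 1).eval x ^^ (C 1).eval (bxor x s) ^^ (C 1).eval (bxor x v) ^^ (C 1).eval (bxor x (bxor s v))) = false) ∧ (∀ u ∈ U, ((Finset.univ.filter fun i => u i && v i).card).bodd = false) ∧ ∀ j, (∀ y z : Fin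 (m + m) → Bool, (((C 1).eval z ^^ (C 1).eval (bxor z (xs j)) ^^ (C 1).eval (bxor z v) ^^ (C 1).eval (bxor z (bxor (xs j) v))) ^^ ((C 1).eval (bxor z y) ^^ (C 1).eval (bxor (bxor z y) (xs j)) ^^ (C 1).eval (bxor (bxor z y) v) ^^ (C 1).eval (bxor (bxor z y) (bxor (xs j) v)))) = false))).card : ℝ)))) ∨
          (∃ r : ℕ, r ≤ m + m + 1 ∧ (2 : ℝ) ^ ((m + m) * r) / ((m + m + 2 : ℝ) ^ 8) ≤ (∑ xs : Fin (r) → (Fin (m + m) → Bool), (((@Finset.filter (Fin (m + m) → Bool) (fun v => v ∉ U ∧ (∃ V : Finset (Fin (m + m) → Bool), ((zeroVec ∈ V ∧ ∀ x ∈ V, ∀ y ∈ V, bxor x y ∈ V) ∧ (((V).card : ℝ) ^ 2 = (2 : ℝ) ^ (m + m)) ∧ ∀ u ∈ V, ∀ v ∈ V, ∀ x, ((C 0).eval x ^^ (C 0).eval (bxor x u) ^^ (C 0).eval (bxor x v) ^^ (C 0).eval (bxor x (bxor u v))) = false) ∧ U ⊆ V ∧ v ∈ V ∧ (∀ s ∈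 V, ∀ u ∈ S, ((Finset.univ.filter fun i => s i && u i).card).bodd = false))) (Classical.decPred _) (Finset.univ.filter fun (v : Fin (m + m) → Bool) => (∀ s ∈ U, ∀ x, ((C 0).eval x ^^ (C 0).eval (bxor x s) ^^ (C 0).eval (bxor x v) ^^ (C 0).eval (bxor x (bxor s v))) = false) ∧ (∀ u ∈ S, ((Finset.univ.filter fun i => u i && v i).card).bodd = false) ∧ ∀ j, (∀ y z : Fin (m + m) → Bool, (((C 0).eval z ^^ (C 0).eval (bxor z (xs j)) ^^ (C 0).eval (bxor z v) ^^ (C 0).eval (bxor z (bxor (xs j) v))) ^^ ((C 0).eval (bxor z y) ^^ (C 0).eval (bxor (bxor z y) (xs j)) ^^ (C 0).eval (bxor (bxor z y) v) ^^ (C 0).eval (bxor (bxor z y) (bxor (xs j) v)))) = false))).card : ℝ) / (((Finset.univ.filter fun (v : Fin (m + m) → Bool) => (∀ s ∈ U, ∀ x, ((C 0).eval x ^^ (C 0).eval (bxor x s) ^^ (C 0).eval (bxor x v) ^^ (C 0).eval (bxor x (bxor s v))) = false) ∧ (∀ u ∈ S, ((Finset.univ.filter fun i => u i && v i).card).bodd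 = false) ∧ ∀ j, (∀ y z : Fin (m + m) → Bool, (((C 0).eval z ^^ (C 0).eval (bxor z (xs j)) ^^ (C 0).eval (bxor z v) ^^ (C 0).eval (bxor z (bxor (xs j) v))) ^^ ((C 0).eval (bxor z y) ^^ (C 0).eval (bxor (bxor z y) (xs j)) ^^ (C 0).eval (bxor (bxor z y) v) ^^ (C 0).eval (bxor (bxor z y) (bxor (xs j) v)))) = false))).card : ℝ))))) →
    (∀ (n : ℕ) (a b : (Fin n → Bool) → Bool) (V : Finset (Fin n → Bool)),
        IsDegLeFun 3 a → IsDegLeFun 3 b → (forrelation a b = 1 ∨ forrelation a b = -1) →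
        ((zeroVec ∈ V ∧ ∀ x ∈ V, ∀ y ∈ V, bxor x y ∈ V) ∧ (((V).card : ℝ) ^ 2 = (2 : ℝ) ^ (n)) ∧ ∀ u ∈ V, ∀ v ∈ V, ∀ x, (b x ^^ b (bxor x u) ^^ b (bxor x v) ^^ b (bxor x (bxor u v))) = false) →
        ((∀ s ∈ V, ∀ y : Fin (n) → Bool, (fun k => (b zeroVec ^^ b (bxor zeroVec s) ^^ b (bxor zeroVec y) ^^ b (bxor zeroVec (bxor s y))) ^^ (b (fun j => decide (j = k)) ^^ b (bxor (fun j => decide (j = k)) s) ^^ b (bxor (fun j => decide (j = k)) y) ^^ b (bxor (fun j => decide (j = k)) (bxor s y)))) ∈ (Finset.univ.filter fun (y : Fin (n) → Bool) => ∀ s ∈ V, ((Finset.univ.filter fun i => s i && y i).card).bodd = false)) ∧ (∀ s ∈ V, ∃ ℓ ∈ (Finset.univ.filter fun (y : Fin (n) → Bool) => ∀ s ∈ V, ((Finset.univ.filter fun i => s i && y i).card).bodd = false), ∀ r : Fin (n) → Bool, (∀ y z : Fin (n) → Bool, ((b z ^^ b (bxor z s) ^^ b (bxor z r) ^^ b (bxor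 z (bxor s r))) ^^ (b (bxor z y) ^^ b (bxor (bxor z y) s) ^^ b (bxor (bxor z y) r) ^^ b (bxor (bxor z y) (bxor s r)))) = false) → (b r ^^ b (bxor r s) ^^ b zeroVec ^^ b s) = ((Finset.univ.filter fun i => ℓ i && r i).card).bodd)) ∧
        ((∀ s ∈ (Finset.univ.filter fun (y : Fin (n) → Bool) => ∀ s ∈ V, ((Finset.univ.filter fun i => s i && y i).card).bodd = false), ∀ y : Fin (n) → Bool, (fun k => (a zeroVec ^^ a (bxor zeroVec s) ^^ a (bxor zeroVec y) ^^ a (bxor zeroVec (bxor s y))) ^^ (a (fun j => decide (j = k)) ^^ a (bxor (fun j => decide (j = k)) s) ^^ a (bxor (fun j => decide (j = k)) y) ^^ a (bxor (fun j => decide (j = k)) (bxor s y)))) ∈ V) ∧ (∀ s ∈ (Finset.univ.filter fun (y : Fin (n) → Bool) => ∀ s ∈ V, ((Finset.univ.filter fun i => s i && y i).card).bodd = false), ∃ ℓ ∈ V, ∀ r : Fin (n) → Bool, (∀ y z : Fin (n) → Bool, ((a z ^^ a (bxor z s) ^^ a (bxor z r) ^^ a (bxor z (bxor s r))) ^^ (a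 (bxor z y) ^^ a (bxor (bxor z y) s) ^^ a (bxor (bxor z y) r) ^^ a (bxor (bxor z y) (bxor s r)))) = false) → (a r ^^ a (bxor r s) ^^ a zeroVec ^^ a s) = ((Finset.univ.filter fun i => ℓ i && r i).card).bodd)) ∧
        (∀ s ∈ V, ∀ u ∈ (Finset.univ.filter fun (y : Fin (n) → Bool) => ∀ s ∈ V, ((Finset.univ.filter fun i => s i && y i).card).bodd = false), ((Finset.univ.filter fun i => s i && u i).card).bodd = false)) →
    ∃ find ∈ FP, ∃ p : Polynomial ℕ, ∀ (m : ℕ) (C : Fin 2 → Circuit (Fin (m + m))),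
        (⟨m + m, 2, C⟩ : KForrelationInstance).IsOverB2 →
        (∀ i, IsDegLeFun 3 (C i).eval) →
        (forrelation (C 0).eval (C 1).eval = 1 ∨ forrelation (C 0).eval (C 1).eval = -1) →
        (∃ e : (Fin (m + m) → Bool) ≃ (Fin (m + m) → Bool),
          (∃ M : Matrix (Fin (m + m)) (Fin (m + m)) (ZMod 2), ∃ c : Fin (m + m) → ZMod 2,
            ∀ y i, (if e y i then (1 : ZMod 2) else 0) = (M.mulVec (fun j => if y j then (1 : ZMod 2) else 0) + c) i) ∧
          ∃ perm : (Fin m → Bool) ≃ (Fin m → Bool), ∃ h : (Fin m → Bool) → Bool, ∀ y' y'' : Fin m → Bool,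
            (if (C 1).eval (e (Fin.append y' y'')) then (1 : ZMod 2) else 0) =
              (∑ i, (if y' i then (1 : ZMod 2) else 0) * (if perm y'' i then (1 : ZMod 2) else 0)) +
                (if h y'' then (1 : ZMod 2) else 0)) →
        (∀ (y : List Bool) (L : List (List Bool)),
            find (boolPair (KForrelationInstance.encode ⟨m + m, 2, C⟩) y) = encList L → L ≠ [] →
            ((zeroVec ∈ (@Finset.filter (Fin (m + m) → Bool) (fun v => (fun i => if v i then (1 : ZMod 2) else 0) ∈ F2Elim.rowSpan (m + m) L) (Classical.decPred _) Finset.univ) ∧ ∀ x ∈ (@Finset.filter (Fin (m + m) → Bool) (fun v => (fun i => if v i then (1 : ZMod 2) else 0) ∈ F2Elim.rowSpan (m + m) L) (Classical.decPred _) Finset.univ), ∀ y ∈ (@Finset.filter (Fin (m + m) → Bool) (fun v => (fun i => if v i then (1 : ZMod 2) else 0) ∈ F2Elim.rowSpan (m + m) L) (Classical.decPred _) Finset.univ), bxor x y ∈ (@Finset.filter (Fin (m + m) → Bool) (fun v => (fun i => if v i then (1 : ZMod 2) else 0) ∈ F2Elim.rowSpan (m + m) L) (Classical.decPred _) Finset.univ))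 ∧ ((((@Finset.filter (Fin (m + m) → Bool) (fun v => (fun i => if v i then (1 : ZMod 2) else 0) ∈ F2Elim.rowSpan (m + m) L) (Classical.decPred _) Finset.univ)).card : ℝ) ^ 2 = (2 : ℝ) ^ (m + m)) ∧ ∀ u ∈ (@Finset.filter (Fin (m + m) → Bool) (fun v => (fun i => if v i then (1 : ZMod 2) else 0) ∈ F2Elim.rowSpan (m + m) L) (Classical.decPred _) Finset.univ), ∀ v ∈ (@Finset.filter (Fin (m + m) → Bool) (fun v => (fun i => if v i then (1 : ZMod 2) else 0) ∈ F2Elim.rowSpan (m + m) L) (Classical.decPred _) Finset.univ), ∀ x, ((C 1).eval x ^^ (C 1).eval (bxor x u) ^^ (C 1).eval (bxor x v) ^^ (C 1).eval (bxor x (bxor u v))) = false)) ∧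
        (2 / 3 : ℝ) ≤ uniformProb (p.eval (KForrelationInstance.encode ⟨m + m, 2, C⟩).length)
            {y | ∃ L : List (List Bool), L ≠ [] ∧ find (boolPair (KForrelationInstance.encode ⟨m + m, 2, C⟩) y) = encList L} := by
  intro hK hM
  refine ⟨growFind, growFind_mem_FP, 3 * (Polynomial.X + 1) ^ 2 * (Polynomial.X + 3) ^ 10, fun m C hB2 hdeg hΦ horb => ⟨?_, ?_⟩⟩
  · exact growFind_sound m C hdeg
  · exact growFind_complete hK hM m C hB2 hdeg hΦ horb

end Summit.QuantumAdvantage.QuantumAdvantage.Theorems.SignedExactCubicForrelationNotPrBPP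

end
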